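import Summits.HodgeConjecture.CorCM.Census.QuarticTwistScrewLaw

/-!
# The quartic twist `(ℤ/4 × B, (2,0))`, XVI: NO SCREW TYPES — the orientation parity and the HALF-PARITY FUNCTIONAL

COR-CM (cell `pub-hodgecm2`), count-neutral kernel combinatorics by the binder seat b09 (gen 32; lane QUARTIC-TWIST), part XVI, sequel of part XV
(`QuarticTwistScrewLaw`); the law itself is part XVII (`QuarticTwistNoScrew`).  Two bookkeeping definitions (`fpar`, `parF` — the half-parity functional and its join with the block parities) +
theorems; no `decide` table (closed `ℤ/4`/`𝔽₂` trivia by `decide`), no certificate, no named fact, no geometry, no `sorry`.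
HONEST FRAMING: `HC_CM` is NOT proved; nothing here is a headline or a period.

THE MISSING FUNCTIONAL.  For `|B|` even the block parities of part IX see only `β − 2` dimensions of the Hodge lattice `H`; the lane-note numerics
(`dim H/(I_G H + 2H) = β − 1` for `B = ℤ/2, ℤ/2², ℤ/6, S₃, ℤ/2³`) asked for one more `G`-invariant functional `H → 𝔽₂`, necessarily NOT the
restriction of a `G`-invariant functional on all exponent vectors.  Here it is.  ORIENTATION PARITY (**`exists_parity`**): if `B` has NO screw type
(`(1,t)·ψ ≠ ψ` for all `ψ, t` — iff no element of order divisible by `4`, part XIV), every stabiliser has even first components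
(`par_fst_eq_zero_of_noScrew`), so `c(g·r_ω) := g₁ mod 2` is a well-defined `c : Ty → 𝔽₂` with `c((v,t)·s) = c(s) + v`.  HALF-PARITY
(**`fpar`**): `f_{b₀}(m) = Σ_s [s(b₀) ≡ c(s) (mod 2)]·m(s) mod 2`.  It kills the pairs (`fpar_pairVec`); a Galois translation moves the base
column, `f_{b₀}((v,t)·m) = f_{b₀+t}(m)` (`fpar_transl`); and ON HODGE VECTORS the base column does not matter (**`fpar_eq_of_mem_hodge`**: 
`f_{b₀}(m) − f_{b₁}(m) = Σ_s m(s)[s(b₀) ≢ s(b₁)] = Σ_s m(s)([χ_{0,b₀} ≠ χ_{0,b₁}] + [χ_{1,b₀} ≠ χ_{1,b₁}])(s) ≡ 0`, each summand a halved difference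
of two Pohlmann forms, `sum_mul_dind_eq_zero`).  So `f` is a `G`-invariant functional on `H` killing the pairs, and `f(w_1) = 1` for `|B|` even
(`fpar_Wvec_one`), while `w_1` is invisible to every block parity.  THE LAW (**`card_orb_le_card_add_one_of_noScrew`**): with no screw type, every
family `S ⊆ H` whose Galois translates generate `H` modulo the pairs has `|S| ≥ β − 1` (for `|B|` odd this is part IX, for `|B|` even the
`β − 1` vectors of part IX have independent `(parities, f)`-values).  THE COMPLETE LAW OF THE QUARTIC TWIST (**`quarticTwist_law_noScrew`** with parts
IX, XII, XV): for every finite group `B` with `|B| ≥ 3`, the least number of Galois orbits of HODGE generators of the Hodge lattice of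
`(ℤ/4 × B, (2,0))` modulo divisor classes is `β − 1 − [B has an element of order divisible by 4]`, attained by rank-four faces.  All [folklore].

## References
* [Pohlmann1968] H. Pohlmann, Algebraic cycles on abelian varieties of complex multiplication type, Ann. of Math. 88 (1968), Thm 1.
* [Milne1999] J. S. Milne, Lefschetz motives and the Tate conjecture, Compositio Math. 117 (1999), Prop. 2.1, p. 54.
-/

namespace Summit.HodgeConjecture.CorCM.Census.QuarticTwist

open Finset

variable (B : Type) [AddGroup B] [Fintype B] [DecidableEq B]

/-! ## §1 No screw types: the orientation parity -/

omit [Fintype B] [DecidableEq B] in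
/-- Without screw types every stabiliser element has even first component. [folklore] -/
theorem par_fst_eq_zero_of_noScrew (hns : ∀ (ψ : Ty B) (t : B), tw B (1, t) ψ ≠ ψ) {e : ZMod 4 × B} {r : Ty B}
    (he : tw B e r = r) : par e.1 = 0 := by
  have key : ∀ v : ZMod 4, par v = 0 ∨ v = 1 ∨ v = -1 := by decide
  rcases key e.1 with h | h | h
  · exact h
  · refine absurd ?_ (hns r e.2)
    rw [show ((1 : ZMod 4), e.2) = e from Prod.ext h.symm rfl]; exact he
  · have he' : tw B (-e) r = r := by
      have h' := congrArg (tw B (-e)) he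
      rw [tw_neg_tw] at h'
      exact h'.symm
    refine absurd ?_ (hns r (-e).2)
    rw [show ((1 : ZMod 4), (-e).2) = -e from Prod.ext (by rw [Prod.fst_neg, h, neg_neg]) rfl]; exact he'

omit [Fintype B] [DecidableEq B] in
/-- **The orientation parity**: without screw types there is `c : Ty → 𝔽₂` with `c((v,t)·s) = c(s) + v mod 2`. [folklore] -/
theorem exists_parity (hns : ∀ (ψ : Ty B) (t : B), tw B (1, t) ψ ≠ ψ) :
    ∃ c : Ty B → ZMod 2, ∀ (g : ZMod 4 × B) (s : Ty B), c (tw B g s) = c s + par g.1 := by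
  classical
  have hg0 : ∀ s : Ty B, ∃ g : ZMod 4 × B, tw B g (Quotient.mk (orbitRel B) s).out = s := fun s => by
    have h' : (orbitRel B).r (Quotient.mk (orbitRel B) s).out s := Quotient.exact (Quotient.out_eq _)
    exact h'
  choose gsel hgsel using hg0
  refine ⟨fun s => par (gsel s).1, fun g s => ?_⟩
  show par (gsel (tw B g s)).1 = par (gsel s).1 + par g.1
  have hq : (Quotient.mk (orbitRel B) (tw B g s) : Orb B) = Quotient.mk (orbitRel B) s := Quotient.sound ⟨-g, tw_neg_tw B g s⟩
  obtain ⟨r, hr⟩ : ∃ r, (Quotient.mk (orbitRel B) s).out = r := ⟨_, rfl⟩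
  obtain ⟨g', hg'⟩ : ∃ g', gsel (tw B g s) = g' := ⟨_, rfl⟩
  have h1 : tw B (gsel s) r = s := by rw [← hr]; exact hgsel s
  have h2 : tw B g' r = tw B g s := by rw [← hg', ← hr, ← hq]; exact hgsel (tw B g s)
  have he : tw B (-g' + (g + gsel s)) r = r := by
    rw [← tw_tw, ← tw_tw, h1, ← h2, tw_neg_tw]
  have hpar := par_fst_eq_zero_of_noScrew B hns he
  simp only [Prod.fst_add, Prod.fst_neg, map_add, map_neg, ZMod.neg_eq_self_mod_two] at hpar
  rw [hg']
  have key : ∀ x y z : ZMod 2, x + (y + z) = 0 → x = z + y := by decide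
  exact key _ _ _ hpar

/-! ## §2 The half-parity functional -/

/-- **The half-parity functional** `f_{b₀}(m) = Σ_s [s(b₀) ≡ c(s) (mod 2)]·m(s) mod 2`. [folklore] -/
noncomputable def fpar (b₀ : B) (c : Ty B → ZMod 2) : (Ty B → ℤ) →ₗ[ℤ] ZMod 2 where
  toFun m := ∑ s, (m s : ZMod 2) * (if par (s b₀) = c s then 1 else 0)
  map_add' m m' := by
    simp only [Pi.add_apply, Int.cast_add, add_mul, Finset.sum_add_distrib]
  map_smul' a m := by
    simp only [Pi.smul_apply, smul_eq_mul, Int.cast_mul, RingHom.id_apply, Finset.mul_sum, zsmul_eq_mul, mul_assoc]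

omit [AddGroup B] in
/-- `fpar` of a unit vector. [folklore] -/
theorem fpar_single (b₀ : B) (c : Ty B → ZMod 2) (s : Ty B) (a : ℤ) :
    fpar B b₀ c (Pi.single s a) = (a : ZMod 2) * (if par (s b₀) = c s then 1 else 0) := by
  show ∑ s', ((Pi.single s a : Ty B → ℤ) s' : ZMod 2) * (if par (s' b₀) = c s' then 1 else 0) = _
  rw [Finset.sum_eq_single s]
  · rw [Pi.single_eq_same]
  · intro s' _ hs'
    rw [Pi.single_eq_of_ne hs', Int.cast_zero, zero_mul]
  · intro h
    exact absurd (mem_univ s) h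

/-- **`fpar` kills the pairs** (`c(s + 2) = c(s)`, `s(b₀) + 2 ≡ s(b₀)`). [folklore] -/
theorem fpar_pairVec {c : Ty B → ZMod 2} (hc : ∀ (g : ZMod 4 × B) (s : Ty B), c (tw B g s) = c s + par g.1) (b₀ : B) (s : Ty B) :
    fpar B b₀ c (pairVec B s) = 0 := by
  unfold pairVec
  have e1 : tw B (2, 0) s b₀ = s b₀ + 2 := by simp only [tw, add_zero]
  have e2 : ∀ x : ZMod 4, par (x + 2) = par x := by decide
  have e3 : par (2 : ZMod 4) = 0 := by decide
  have e4 : ∀ x : ZMod 2, x + x = 0 := by decide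
  rw [← tw_two_zero, map_add, fpar_single, fpar_single, hc, e1, e2]
  simp only [e3, add_zero, Int.cast_one, one_mul, e4]

/-- **A Galois translation moves the base column**: `f_{b₀}((v,t)·m) = f_{b₀+t}(m)`. [folklore] -/
theorem fpar_transl {c : Ty B → ZMod 2} (hc : ∀ (g : ZMod 4 × B) (s : Ty B), c (tw B g s) = c s + par g.1) (b₀ : B)
    (h : ZMod 4 × B) (m : Ty B → ℤ) : fpar B b₀ c (transl B h m) = fpar B (b₀ + h.2) c m := by
  show ∑ s, ((transl B h m) s : ZMod 2) * (if par (s b₀) = c s then 1 else 0)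
    = ∑ s, (m s : ZMod 2) * (if par (s (b₀ + h.2)) = c s then 1 else 0)
  refine Fintype.sum_equiv (twEquiv B (-h)) _ _ fun s => ?_
  have e1 : (twEquiv B (-h)) s = tw B (-h) s := rfl
  have e2 : tw B (-h) s (b₀ + h.2) = s b₀ - h.1 := by
    simp only [tw, Prod.snd_neg, Prod.fst_neg, ← sub_eq_add_neg, add_sub_cancel_right]
  have e3 : c (tw B (-h) s) = c s - par h.1 := by rw [hc, Prod.fst_neg, map_neg, ← sub_eq_add_neg]
  have e4 : transl B h m s = m (tw B (-h) s) := rfl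
  rw [e1, e2, e3, e4]
  simp only [map_sub, sub_left_inj]

omit [AddGroup B] in
/-- Halved differences of Pohlmann forms vanish mod `2` on Hodge vectors: `Σ_s m(s)·[χ_g(s) ≠ χ_{g'}(s)] ≡ 0`. [folklore] -/
theorem sum_mul_dind_eq_zero {m : Ty B → ℤ} (hm : m ∈ hodge B) (g g' : ZMod 4 × B) :
    ∑ s, (m s : ZMod 2) * (if coef B g s = coef B g' s then 0 else 1) = 0 := by
  have h0 : ∑ s, coef B g s * m s = 0 := hm g
  have h1 : ∑ s, coef B g' s * m s = 0 := hm g'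
  have hsgn : ∀ (g : ZMod 4 × B) (s : Ty B), coef B g s = 1 ∨ coef B g s = -1 := by
    intro g s; unfold coef; split_ifs
    · exact Or.inl rfl
    · exact Or.inr rfl
  have h2 : ∑ s, (coef B g s - coef B g' s) * m s = 0 := by
    simp only [sub_mul, Finset.sum_sub_distrib, h0, h1, sub_self]
  have hd : ∀ s, coef B g s - coef B g' s = 2 * (if coef B g s = coef B g' s then 0 else coef B g s) := by
    intro s
    rcases hsgn g s with e | e <;> rcases hsgn g' s with e' | e' <;> rw [e, e'] <;> decide
  have h3 : 2 * ∑ s, (if coef B g s = coef B g' s then 0 else coef B g s) * m s = ∑ s, (coef B g s - coef B g' s) * m s := by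
    rw [Finset.mul_sum]
    refine Finset.sum_congr rfl fun s _ => ?_
    rw [hd, mul_assoc]
  rw [h2] at h3
  have h4 : ∑ s, (if coef B g s = coef B g' s then 0 else coef B g s) * m s = 0 := by
    rcases mul_eq_zero.mp h3 with h | h
    · exact absurd h two_ne_zero
    · exact h
  have h6 : ∑ s, (m s : ZMod 2) * (if coef B g s = coef B g' s then 0 else 1)
      = (((∑ s, (if coef B g s = coef B g' s then 0 else coef B g s) * m s : ℤ) : ℤ) : ZMod 2) := by
    rw [Int.cast_sum]
    refine Finset.sum_congr rfl fun s _ => ?_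
    split_ifs with h
    · simp
    · rcases hsgn g s with e | e <;> simp [e, ZMod.neg_eq_self_mod_two]
  rw [h6, h4, Int.cast_zero]

omit [AddGroup B] in
/-- **ON HODGE VECTORS THE BASE COLUMN DOES NOT MATTER**: `f_{b₀}(m) = f_{b₁}(m)` for `m ∈ H`. [folklore] -/
theorem fpar_eq_of_mem_hodge (c : Ty B → ZMod 2) (b₀ b₁ : B) {m : Ty B → ℤ} (hm : m ∈ hodge B) :
    fpar B b₀ c m = fpar B b₁ c m := by
  have key : ∀ (x y : ZMod 4) (cc : ZMod 2), ((if par x = cc then (1 : ZMod 2) else 0) - if par y = cc then 1 else 0)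
      = (if ((if (0 : ZMod 4) = x ∨ 0 = x + 1 then (1 : ℤ) else -1) = if (0 : ZMod 4) = y ∨ 0 = y + 1 then 1 else -1) then 0 else 1)
        + (if ((if (1 : ZMod 4) = x ∨ 1 = x + 1 then (1 : ℤ) else -1) = if (1 : ZMod 4) = y ∨ 1 = y + 1 then 1 else -1) then 0 else 1) := by
    decide
  rw [← sub_eq_zero]
  show ∑ s, (m s : ZMod 2) * (if par (s b₀) = c s then 1 else 0) - ∑ s, (m s : ZMod 2) * (if par (s b₁) = c s then 1 else 0) = 0
  rw [← Finset.sum_sub_distrib]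
  have e : ∀ s : Ty B, (m s : ZMod 2) * (if par (s b₀) = c s then 1 else 0) - (m s : ZMod 2) * (if par (s b₁) = c s then 1 else 0)
      = (m s : ZMod 2) * ((if coef B (0, b₀) s = coef B (0, b₁) s then 0 else 1)
        + (if coef B (1, b₀) s = coef B (1, b₁) s then 0 else 1)) := by
    intro s
    rw [← mul_sub]
    congr 1
    simp only [coef]
    exact key (s b₀) (s b₁) (c s)
  rw [Finset.sum_congr rfl fun s _ => e s]
  simp only [mul_add, Finset.sum_add_distrib, sum_mul_dind_eq_zero B hm, add_zero]

/-- **`fpar` is Galois-invariant on Hodge vectors.** [folklore] -/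
theorem fpar_transl_of_mem_hodge {c : Ty B → ZMod 2} (hc : ∀ (g : ZMod 4 × B) (s : Ty B), c (tw B g s) = c s + par g.1) (b₀ : B)
    (h : ZMod 4 × B) {m : Ty B → ℤ} (hm : m ∈ hodge B) : fpar B b₀ c (transl B h m) = fpar B b₀ c m := by
  rw [fpar_transl B hc, fpar_eq_of_mem_hodge B c (b₀ + h.2) b₀ hm]

/-- **`f(w_1) = 1` for `|B|` even.** [folklore] -/
theorem fpar_Wvec_one {c : Ty B → ZMod 2} (hc : ∀ (g : ZMod 4 × B) (s : Ty B), c (tw B g s) = c s + par g.1)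
    (hev : Even (Fintype.card B)) (b₀ : B) : fpar B b₀ c (Wvec B 1) = 1 := by
  have hc1 : c (cst B 1) = c (cst B 0) + 1 := by
    have h := hc (1, 0) (cst B 0)
    rw [tw_cst, zero_add] at h
    rw [h]
    congr 1
  have hca : ∀ b : B, c (atom B 1 b (-1)) = c (atom B 1 b₀ (-1)) := by
    intro b
    have h := hc (0, -b + b₀) (atom B 1 b₀ (-1))
    rw [tw_atom, sub_neg_add_self] at h
    simp only [add_zero, map_zero] at h
    exact h
  obtain ⟨κ, hκ⟩ : ∃ κ, c (atom B 1 b₀ (-1)) = κ := ⟨_, rfl⟩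
  obtain ⟨κ₀, hκ₀⟩ : ∃ κ₀, c (cst B 0) = κ₀ := ⟨_, rfl⟩
  have v0 : fpar B b₀ c (Pi.single (cst B 0) 1) = if par (0 : ZMod 4) = κ₀ then 1 else 0 := by
    rw [fpar_single, Int.cast_one, one_mul, hκ₀]; rfl
  have v1 : fpar B b₀ c (Pi.single (cst B 1) 1) = if par (1 : ZMod 4) = κ₀ + 1 then 1 else 0 := by
    rw [fpar_single, Int.cast_one, one_mul, hc1, hκ₀]; rfl
  have va : ∀ b : B, fpar B b₀ c (Pi.single (atom B 1 b (-1)) 1)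
      = if b₀ = b then (if par (0 : ZMod 4) = κ then 1 else 0) else (if par (1 : ZMod 4) = κ then 1 else 0) := by
    intro b
    rw [fpar_single, Int.cast_one, one_mul, hca b, hκ, atom_apply]
    by_cases h : b₀ = b
    · rw [if_pos h, if_pos h, show (1 : ZMod 4) + -1 = 0 by decide]
    · rw [if_neg h, if_neg h]
  have vsum : ∑ b, fpar B b₀ c (Pi.single (atom B 1 b (-1)) 1)
      = (if par (0 : ZMod 4) = κ then 1 else 0) + (Fintype.card B - 1) • (if par (1 : ZMod 4) = κ then (1 : ZMod 2) else 0) := by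
    rw [Finset.sum_congr rfl fun b _ => va b, ← Finset.add_sum_erase _ _ (mem_univ b₀), if_pos rfl,
      Finset.sum_congr rfl fun b hb => if_neg (Ne.symm (ne_of_mem_erase hb)), Finset.sum_const,
      Finset.card_erase_of_mem (mem_univ b₀), card_univ]
  have hpos : 1 ≤ Fintype.card B := Fintype.card_pos_iff.mpr ⟨b₀⟩
  obtain ⟨k, hk⟩ := hev
  have hn0 : ((Fintype.card B : ℕ) : ZMod 2) = 0 := by
    rw [hk, Nat.cast_add]
    have e : ∀ x : ZMod 2, x + x = 0 := by decide
    exact e _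
  have hn1 : ((Fintype.card B - 1 : ℕ) : ZMod 2) = 1 := by
    rw [show Fintype.card B - 1 = 2 * (k - 1) + 1 by omega, Nat.cast_add, Nat.cast_mul, Nat.cast_one,
      show ((2 : ℕ) : ZMod 2) = 0 by decide, zero_mul, zero_add]
  unfold Wvec
  rw [map_sub, map_sub, map_smul, map_sum, sub_self, vsum, v1, v0, zsmul_eq_mul, nsmul_eq_mul, hn1, one_mul, Int.cast_sub,
    Int.cast_one, Int.cast_natCast, hn0]
  have key : ∀ κ κ₀ : ZMod 2, (if par (0 : ZMod 4) = κ then (1 : ZMod 2) else 0) + (if par (1 : ZMod 4) = κ then 1 else 0)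
      - (0 - 1) * (if par (1 : ZMod 4) = κ₀ + 1 then 1 else 0) - (if par (0 : ZMod 4) = κ₀ then 1 else 0) = 1 := by decide
  exact key κ κ₀

/-! ## §3 The joined functional `(f, block parities)` and the span of a Hodge family -/

/-- The half-parity joined with the block parities: `m ↦ (f(m), (P_ω(m))_ω)` on `Option (Orb B)`. [folklore] -/
noncomputable def parF (b₀ : B) (c : Ty B → ZMod 2) : (Ty B → ℤ) →ₗ[ℤ] (Option (Orb B) → ZMod 2) where
  toFun m := fun x => Option.elim x (fpar B b₀ c m) (fun ω => parVec B m ω)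
  map_add' m m' := by
    funext x; rcases x with _ | ω
    · show fpar B b₀ c (m + m') = fpar B b₀ c m + fpar B b₀ c m'
      exact map_add _ _ _
    · show parVec B (m + m') ω = parVec B m ω + parVec B m' ω
      rw [map_add]; rfl
  map_smul' a m := by
    funext x; rcases x with _ | ω
    · show fpar B b₀ c (a • m) = a • fpar B b₀ c m
      exact map_smul _ _ _
    · show parVec B (a • m) ω = a • parVec B m ω
      rw [map_smul]; rfl

/-- `parF` at `none` is `fpar`. [folklore] -/
theorem parF_apply_none (b₀ : B) (c : Ty B → ZMod 2) (m : Ty B → ℤ) : parF B b₀ c m none = fpar B b₀ c m := rfl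

/-- `parF` at `some ω` is the block parity. [folklore] -/
theorem parF_apply_some (b₀ : B) (c : Ty B → ZMod 2) (m : Ty B → ℤ) (ω : Orb B) : parF B b₀ c m (some ω) = parVec B m ω := rfl

/-- **The `(f, parities)` of `pairs ⊔ ℤ[G]·S` lie in the `𝔽₂`-span of those of `S`, for `S` made of Hodge vectors.** [folklore] -/
theorem parF_mem_span_of_mem {c : Ty B → ZMod 2} (hc : ∀ (g : ZMod 4 × B) (s : Ty B), c (tw B g s) = c s + par g.1) {b₀ : B}
    (S : Finset (Ty B → ℤ)) (hSH : ∀ v ∈ S, v ∈ hodge B) {m : Ty B → ℤ}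
    (hm : m ∈ pairs B ⊔ Submodule.span ℤ {w : Ty B → ℤ | ∃ g : ZMod 4 × B, ∃ v ∈ S, w = transl B g v}) :
    parF B b₀ c m ∈ Submodule.span (ZMod 2) ((S.image (parF B b₀ c) : Finset _) : Set (Option (Orb B) → ZMod 2)) := by
  set T := Submodule.span (ZMod 2) ((S.image (parF B b₀ c) : Finset _) : Set (Option (Orb B) → ZMod 2)) with hT
  have hle : pairs B ⊔ Submodule.span ℤ {w : Ty B → ℤ | ∃ g : ZMod 4 × B, ∃ v ∈ S, w = transl B g v} ≤
      (T.restrictScalars ℤ).comap (parF B b₀ c) := by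
    refine sup_le (Submodule.span_le.mpr ?_) (Submodule.span_le.mpr ?_)
    · rintro _ ⟨ψ, rfl⟩
      show parF B b₀ c (pairVec B ψ) ∈ T
      have e : parF B b₀ c (pairVec B ψ) = 0 := by
        funext x; rcases x with _ | ω
        · exact fpar_pairVec B hc b₀ ψ
        · exact congrFun (parVec_pairVec B ψ) ω
      rw [e]; exact T.zero_mem
    · rintro _ ⟨g, v, hv, rfl⟩
      show parF B b₀ c (transl B g v) ∈ T
      have e : parF B b₀ c (transl B g v) = parF B b₀ c v := by
        funext x; rcases x with _ | ω
        · exact fpar_transl_of_mem_hodge B hc b₀ g (hSH v hv)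
        · exact congrFun (parVec_transl B g v) ω
      rw [e]
      exact Submodule.subset_span (Finset.mem_coe.mpr (Finset.mem_image_of_mem _ hv))
  exact hle hm

end Summit.HodgeConjecture.CorCM.Census.QuarticTwist
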